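import Summits.QuantumFields.BalabanUV.T4Continuum.Support.NE3EnergyMix

/-!
# T⁴ programme, node NE3, route P2 «ENERGY CONVEXITY» — leaf L11 «MIX» (typer sub-row S5-Y11), SHAPE HALF: the
# hypothesis structure `HBound` (the constraint right inverse `H_W` is `ℓ²(unit torus) → energy(fine torus)` bounded)
# and the kernel lemma `dDiff_le_of_mix` delivering the field `NE3EnergyLipschitz.LipLeaves.mix` in its literal shape

NE3 formalisation swarm, leaf seat `b2b-balaban-t4-ne3-formalise-leaf-05` (gen 3), sub-row S5-Y11 of
`HOME/t4/formal/NE3/LEAVES.md` = leaf L11 «MIX (T-LIP only) — THE CONSTRAINT DATUM ENTERS THROUGH H_W» of road P2's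
skeleton `HOME/t4/skeletons/NE3-t4-ne3-p2.md` §2A: «structure `HBound W C_H` (printed TYPE, typer Y11) + kernel
`dDiff_le_of_mix`».  Companion of `Support/NE3EnergyMix` (the kernel half: mixed second variation along a general path,
`abs_dAction_sub_dAction_le_energy`).  WHAT IS HERE ([folklore]; ONE hypothesis SHAPE, no `def … : Prop` fact):
§5 **`HBound W N P H CH`** (Prop-valued structure; fields `map_sub` ∕ `skew` ∕ `periodic` ∕ `bound`:
   `energyNorm W (H B) (periodBox P) ≤ CH·√(dirSq B (periodBox N))` for skew `N`-periodic data `B`); non-vacuity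
   `hBound_zero` (the zero map); `skew_periodic_sub`; **`dDiff_le_of_mix`**: for unitary `W`, `HBound W N P H CH`, two skew
   `N`-periodic data `B₁, B₂` (`δB := √(dirSq (B₁ − B₂) (periodBox N))`), a tangent datum `X` (`NX := energyNorm W X
   (periodBox P)`), a skew DATUM PATH `σ` (dictionary: `σ s = Φ_W(a(1) + H(B₂ + s(B₁ − B₂)))`) with `P`-periodic
   right-logarithmic velocities `Z s`, `P`-periodic inserted fields `Y s` (the `t`-velocities of the two-parameter family
   `(t,s) ↦ Φ_W(a(t) + H B_s)` at `t = 1`) with derivatives `Y′ s`, and three ONE-configuration CHART-DISTORTION binders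
   on `[0,1]` — (θ₁) `energyNorm W (Z s) ≤ (1+θ₁)·energyNorm W (H (B₁ − B₂))`, (θ₂) `energyNorm W (Y s) ≤ (1+θ₂)·NX`,
   (κH) `|dAction W^σ_s (Y′ s) (perWin d P)| ≤ κH·δB·NX` — the conclusion
   `dAction W^σ_1 (Y 1) (perWin d P) − dAction W^σ_0 (Y 0) (perWin d P) ≤ (48·d·(1+θ₁)·(1+θ₂)·CH + κH)·δB·NX`,
   i.e. `LipLeaves.mix` with `φ₁′ 1 := ψ 1`, `D₂ := ψ 0`, `ΛH := 48·d·(1+θ₁)·(1+θ₂)·CH + κH` (k-uniform given k-uniform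
   binders; `48·d` = P3's Λ = 12 × the torus bond multiplicity `4d`);
§6 `dDiff_le_of_mix_const`: joint satisfiability of all binders on a constant datum path with `H = 0`.
Every binder concerns ONE configuration family on ONE lattice (no minimiser, no two spacings, no rate): the row's
disguise test passes.  The instantiation on Bałaban's chart is the torus instance S5-Y8b ∕ the single writers' business.

HONEST FRAMING.  Finite-T⁴ ultraviolet bookkeeping (rung (B)+1: existence and uniqueness of the ε → 0 limit of
gauge-invariant observables on a FIXED finite torus); a typed hypothesis shape + kernel glue; NOTHING about Bałaban's
minimisers, `Φ_W` or `H_W` is asserted; «T-LIP CONDITIONAL on ⟨named structures⟩» unchanged; NE3 NOT proved; spine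
PROVED 0∕9; NO coercivity (leaf L5, typer ρ19) stated or consumed; no conditional of the cell (`BetaPertH`, (B),
G-an2-4) used or hidden; NOT infinite volume, NOT a mass gap, NOT Clay, NOT summit progress.  ABSOLUTE RULE kept: no
printed sentence is a hypothesis (context only: [Balaban1985Variational] (45)–(46) p. 285 «L^jηQ_jHB = B, RD*HB = 0»,
«|HB| ≤ B₀(Lʲη)⁻¹|B|, |∇HB| ≤ B₀(Lʲη)⁻²|B|», (101)–(102) p. 293; B9 (3.133) p. 422).  PLACEMENT: our lemmas under
`Summits/QuantumFields/BalabanUV/`; imports `Support.NE3EnergyMix` (this seat) only; restates nothing, moves nothing.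
-/

set_option autoImplicit false

open scoped BigOperators Matrix.Norms.L2Operator
open NormedSpace Finset

namespace Summit.QuantumFields.BalabanUV.T4Continuum.NE3EnergyMixShape

open Set
open Literature.MathematicalPhysics.QuantumFieldTheory.Balaban1983to89
open B7Prop1Explicit B7Prop2Explicit MatrixLog UnitaryModel
open T4AveragingDeficitWall hiding Site Plane Plaq Bond
open T4AveragingDeficitWallBoundary (periodBox)
open AveragingDeficitPeriodicCounting (IsPeriodicDir)
open MinimalActionLevels (perWin)
open NE3HessForm (dAction)
open NE3EnergyShapes (energyNorm energyNorm_nonneg energyNorm_zero)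
open NE3EnergyMix (abs_dAction_sub_dAction_le_energy)

noncomputable section

variable {d : ℕ} {n : Type*} [Fintype n] [DecidableEq n]

/-! ## §5 The hypothesis SHAPE `HBound` and the kernel lemma `dDiff_le_of_mix` -/

/-- **`HBound` — THE CONSTRAINT RIGHT INVERSE IS `ℓ² → ENERGY` BOUNDED** (hypothesis SHAPE, road P2's leaf L11, typer
`HBound`).  At the background `W`, a map `H` from constraint data on the unit torus of side `N` (periodic `𝔲(N)`
fields `B`) to direction fields on the fine torus of side `P` (`P = N·L^k` in the dictionary) is additive, preserves
skewness and periodicity, and satisfies `energyNorm W (H B) (periodBox P) ≤ CH·√(dirSq B (periodBox N))`.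
DICTIONARY (context only, nothing printed is asserted): `H = H_W` of [Balaban1985Variational] (45)–(46) p. 285
(«L^jηQ_jHB = B, RD*HB = 0», «|HB| ≤ B₀(Lʲη)⁻¹|B|, |∇HB| ≤ B₀(Lʲη)⁻²|B|») = [Balaban1985BackgroundPropagators] (3.133)
p. 422 TYPE, whose kernel sum gives `CH = B₀·c₁`-TYPE; the exact right-inverse identity is NOT a field (the energy
roads consume only the bound; each road adds the identity it needs).  Asserted for no `W` here. [folklore] -/
@[folklore]
structure HBound (W : Site d → Fin d → (Matrix n n ℂ)ˣ) (N P : ℕ)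
    (H : (Site d → Fin d → Matrix n n ℂ) → (Site d → Fin d → Matrix n n ℂ)) (CH : ℝ) : Prop where
  /-- additivity in the datum (B11's `H` is linear) -/
  map_sub : ∀ B₁ B₂ : Site d → Fin d → Matrix n n ℂ, H (B₁ - B₂) = H B₁ - H B₂
  /-- `H B` is a `𝔲(N)` direction field for `𝔲(N)` data -/
  skew : ∀ B : Site d → Fin d → Matrix n n ℂ, IsSkewDir B → IsSkewDir (H B)
  /-- `H B` is `P`-periodic for `N`-periodic data -/
  periodic : ∀ B : Site d → Fin d → Matrix n n ℂ, IsPeriodicDir B (N : ℤ) → IsPeriodicDir (H B) (P : ℤ)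
  /-- the `ℓ²(unit torus) → energy(fine torus)` bound -/
  bound : ∀ B : Site d → Fin d → Matrix n n ℂ, IsSkewDir B → IsPeriodicDir B (N : ℤ) →
    energyNorm W (H B) (periodBox P) ≤ CH * Real.sqrt (dirSq B (periodBox N))

/-- Non-vacuity of the shape: the zero map satisfies `HBound W N P 0 CH` for every `CH ≥ 0`. [folklore] -/
theorem hBound_zero (W : Site d → Fin d → (Matrix n n ℂ)ˣ) (N P : ℕ) {CH : ℝ} (hCH : 0 ≤ CH) :
    HBound W N P (fun _ => fun _ _ => 0) CH where
  map_sub := fun _ _ => by funext x κ; simp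
  skew := fun _ _ _ _ => (skewAdjoint (Matrix n n ℂ)).zero_mem
  periodic := fun _ _ _ _ _ => rfl
  bound := fun B _ _ => by
    rw [energyNorm_zero]
    exact mul_nonneg hCH (Real.sqrt_nonneg _)

omit [Fintype n] [DecidableEq n] in
/-- The difference of two skew periodic data is skew and periodic. [folklore] -/
theorem skew_periodic_sub {B₁ B₂ : Site d → Fin d → Matrix n n ℂ} {N : ℤ}
    (h₁ : IsSkewDir B₁) (p₁ : IsPeriodicDir B₁ N) (h₂ : IsSkewDir B₂) (p₂ : IsPeriodicDir B₂ N) :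
    IsSkewDir (B₁ - B₂) ∧ IsPeriodicDir (B₁ - B₂) N :=
  ⟨fun x κ => (skewAdjoint (Matrix n n ℂ)).sub_mem (h₁ x κ) (h₂ x κ),
    fun x κ μ => by simp only [Pi.sub_apply, p₁ x κ μ, p₂ x κ μ]⟩

/-- **`dDiff_le_of_mix` — THE FIELD `LipLeaves.mix` IN ITS LITERAL SHAPE.**  Background `W` unitary; `HBound W N P H CH`;
two skew `N`-periodic data `B₁, B₂`, `δB := √(dirSq (B₁ − B₂) (periodBox N))`; a tangent datum `X` with energy
`NX := energyNorm W X (periodBox P)`.  DATUM PATH: skew fields `σ s` (in the dictionary `σ s = Φ_W(a(1) + H(B₂ + s(B₁−B₂)))`,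
so `W^σ_0`, `W^σ_1` are the common-end configurations of the paths of data `B₂`, `B₁`) with `P`-periodic right-logarithmic
velocities `Z s` and `P`-periodic inserted fields `Y s` (the `t`-velocities of the two-parameter family at `t = 1`) with
derivatives `Y′ s`.  CHART-DISTORTION BINDERS on `[0,1]` (each a ONE-configuration statement): (θ₁) `energyNorm W (Z s) ≤
(1+θ₁)·energyNorm W (H (B₁−B₂))`, `0 ≤ θ₁`; (θ₂) `energyNorm W (Y s) ≤ (1+θ₂)·NX`; (κH) `|dAction W^σ_s (Y′ s) (perWin d P)|
≤ κH·δB·NX`.  THEN, with `ψ s := dAction W^σ_s (Y s) (perWin d P)` (so `ψ 1 = φ₁′ 1`, `ψ 0 = D₂` in `LipLeaves`):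
`ψ 1 − ψ 0 ≤ (48·d·(1+θ₁)·(1+θ₂)·CH + κH) · δB · NX` — the `mix` inequality with `ΛH := 48·d·(1+θ₁)·(1+θ₂)·CH + κH`.
[folklore] -/
theorem dDiff_le_of_mix [Nonempty n] {W : Site d → Fin d → (Matrix n n ℂ)ˣ} (hW : IsUnitaryCfg W) {N P : ℕ} (hP : 1 ≤ P)
    {H : (Site d → Fin d → Matrix n n ℂ) → (Site d → Fin d → Matrix n n ℂ)} {CH : ℝ} (hH : HBound W N P H CH)
    {B₁ B₂ : Site d → Fin d → Matrix n n ℂ} (hB₁ : IsSkewDir B₁) (pB₁ : IsPeriodicDir B₁ (N : ℤ))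
    (hB₂ : IsSkewDir B₂) (pB₂ : IsPeriodicDir B₂ (N : ℤ)) (X : Site d → Fin d → Matrix n n ℂ)
    {σ Z Y Y' : ℝ → Site d → Fin d → Matrix n n ℂ} (hσ : ∀ s ∈ Icc (0:ℝ) 1, IsSkewDir (σ s))
    (hE : ∀ s ∈ Icc (0:ℝ) 1, ∀ y κ, HasDerivAt (fun r => exp (σ r y κ)) (exp (σ s y κ) * Z s y κ) s)
    (hYd : ∀ s ∈ Icc (0:ℝ) 1, ∀ y κ, HasDerivAt (fun r => Y r y κ) (Y' s y κ) s)
    (hZp : ∀ s ∈ Icc (0:ℝ) 1, IsPeriodicDir (Z s) (P : ℤ)) (hYp : ∀ s ∈ Icc (0:ℝ) 1, IsPeriodicDir (Y s) (P : ℤ))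
    {θ₁ θ₂ κH : ℝ} (hθ₁ : 0 ≤ θ₁)
    (hZ : ∀ s ∈ Icc (0:ℝ) 1, energyNorm W (Z s) (periodBox P) ≤ (1 + θ₁) * energyNorm W (H (B₁ - B₂)) (periodBox P))
    (hY : ∀ s ∈ Icc (0:ℝ) 1, energyNorm W (Y s) (periodBox P) ≤ (1 + θ₂) * energyNorm W X (periodBox P))
    (hacc : ∀ s ∈ Icc (0:ℝ) 1, |dAction (vary W (σ s) 1) (Y' s) (perWin d P)|
      ≤ κH * Real.sqrt (dirSq (B₁ - B₂) (periodBox N)) * energyNorm W X (periodBox P)) :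
    dAction (vary W (σ 1) 1) (Y 1) (perWin d P) - dAction (vary W (σ 0) 1) (Y 0) (perWin d P)
      ≤ (48 * d * (1 + θ₁) * (1 + θ₂) * CH + κH) * Real.sqrt (dirSq (B₁ - B₂) (periodBox N))
        * energyNorm W X (periodBox P) := by
  set δB := Real.sqrt (dirSq (B₁ - B₂) (periodBox N)) with hδB
  set NX := energyNorm W X (periodBox P) with hNX
  obtain ⟨hδs, hδp⟩ := skew_periodic_sub hB₁ pB₁ hB₂ pB₂
  have hHb : energyNorm W (H (B₁ - B₂)) (periodBox P) ≤ CH * δB := hH.bound _ hδs hδp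
  have hζ : ∀ s ∈ Icc (0:ℝ) 1, energyNorm W (Z s) (periodBox P) ≤ (1 + θ₁) * CH * δB := fun s hs =>
    (hZ s hs).trans (by nlinarith [hHb, hθ₁])
  have h := abs_dAction_sub_dAction_le_energy hW hσ hE hYd hP hZp hYp W W hζ hY hacc
  have hmain := (le_abs_self _).trans h
  have hring : 48 * (d : ℝ) * ((1 + θ₁) * CH * δB * ((1 + θ₂) * NX)) + κH * δB * NX
      = (48 * d * (1 + θ₁) * (1 + θ₂) * CH + κH) * δB * NX := by ring
  linarith [hmain, hring.le, hring.ge]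

/-! ## §6 Non-vacuity: a constant datum path -/

/-- On a CONSTANT datum path (`σ s = σ₀` skew, `Z = 0`, constant periodic inserted field `Y₀`, `Y′ = 0`) every binder of
`dDiff_le_of_mix` holds with `θ₁ = θ₂' := θ₂`, `κH = 0` as soon as `energyNorm W Y₀ ≤ (1+θ₂)·NX`, and the conclusion
reads `0 ≤ …`; recorded as a kernel check that the binders are jointly satisfiable (with `H = 0`, `hBound_zero`).
[folklore] -/
theorem dDiff_le_of_mix_const [Nonempty n] {W : Site d → Fin d → (Matrix n n ℂ)ˣ} (hW : IsUnitaryCfg W)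
    {N P : ℕ} (hP : 1 ≤ P) {CH : ℝ} (hCH : 0 ≤ CH)
    {B₁ B₂ : Site d → Fin d → Matrix n n ℂ} (hB₁ : IsSkewDir B₁) (pB₁ : IsPeriodicDir B₁ (N : ℤ))
    (hB₂ : IsSkewDir B₂) (pB₂ : IsPeriodicDir B₂ (N : ℤ)) (X : Site d → Fin d → Matrix n n ℂ)
    {σ₀ Y₀ : Site d → Fin d → Matrix n n ℂ} (hσ₀ : IsSkewDir σ₀) (hY₀ : IsPeriodicDir Y₀ (P : ℤ)) {θ₂ : ℝ}
    (hY : energyNorm W Y₀ (periodBox P) ≤ (1 + θ₂) * energyNorm W X (periodBox P)) :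
    dAction (vary W σ₀ 1) Y₀ (perWin d P) - dAction (vary W σ₀ 1) Y₀ (perWin d P)
      ≤ (48 * d * (1 + 0) * (1 + θ₂) * CH + 0) * Real.sqrt (dirSq (B₁ - B₂) (periodBox N))
        * energyNorm W X (periodBox P) := by
  have hE : ∀ s ∈ Icc (0:ℝ) 1, ∀ (y : Site d) (κ : Fin d),
      HasDerivAt (fun _ : ℝ => exp (σ₀ y κ)) (exp (σ₀ y κ) * (0 : Matrix n n ℂ)) s := fun s _ y κ => by
    simpa using hasDerivAt_const s (exp (σ₀ y κ))
  have hYd : ∀ s ∈ Icc (0:ℝ) 1, ∀ (y : Site d) (κ : Fin d), HasDerivAt (fun _ : ℝ => Y₀ y κ) (0 : Matrix n n ℂ) s :=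
    fun s _ y κ => hasDerivAt_const s (Y₀ y κ)
  have h0 : ∀ s : ℝ, dAction (vary W σ₀ 1) (fun _ _ => (0 : Matrix n n ℂ)) (perWin d P) = 0 := fun s => by
    simp [dAction, curl, T4AveragingDeficitWall.curlAt, Ad, nReTr]
  have hz : IsPeriodicDir (fun (_ : Site d) (_ : Fin d) => (0 : Matrix n n ℂ)) (P : ℤ) := fun _ _ _ => rfl
  refine dDiff_le_of_mix (σ := fun _ => σ₀) (Z := fun _ _ _ => 0) (Y := fun _ => Y₀) (Y' := fun _ _ _ => 0)
    hW hP (hBound_zero W N P hCH) hB₁ pB₁ hB₂ pB₂ X (fun _ _ => hσ₀) hE hYd (fun _ _ => hz) (fun _ _ => hY₀)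
    (θ₁ := 0) le_rfl (fun s _ => ?_) (fun _ _ => hY) (fun s _ => ?_)
  · simp only [energyNorm_zero, mul_zero, le_refl]
  · simp only [h0 s, abs_zero, zero_mul, le_refl]

end

end Summit.QuantumFields.BalabanUV.T4Continuum.NE3EnergyMixShape
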